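import Summits.BirchSwinnertonDyer.BirchSwinnertonDyer.Theorems.ThetaPartnerAtTwoSignedTransportAtTwoRankZeroOfPoitouTate
import Summits.BirchSwinnertonDyer.BirchSwinnertonDyer.Theorems.ThetaPartnerAtTwoSignedControlAtTwoStubPoitouTateShaRat
import Summits.BirchSwinnertonDyer.BirchSwinnertonDyer.Theorems.ThetaPartnerAtTwoSignedControlAtTwoStubPoitouTateSelmerRat
import Summits.BirchSwinnertonDyer.BirchSwinnertonDyer.Theorems.ThetaPartnerAtTwoSignedControlAtTwoShaThreeBaseH3Units
import Literature.NumberTheory.GaloisCohomology.PoitouTateTwoRealPlacesSurjectiveHolds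
import HarnessLib

/-!
# K1P `SignedTransportAtTwoRankZero` from GZK and `MazurTateCongruenceAtTwoR` ALONE — the four generic Poitou–Tate rows over `ℚ`
# of the K1P door are theorems (route `ThetaPartnerAtTwo`, PUB pack `PublishedInputsGreenbergControlAtTwo` item 24143)

Route `ThetaPartnerAtTwo` (TP2).  Its `closes` consumes K1 at the rank-0 partner through the twin
`SignedTransportAtTwoRankZeroOfPub` (stmt-BirchSwinnertonDyer-25785, CLOSED) = Greenberg⁴ (Cassels 4.13, Prop. 4.12, corank count,
weak Leopoldt) → GZK → `MazurTateCongruenceAtTwoR` → K1Ar, i.e. through four conjuncts of the PUB binder `hPubG`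
(`PublishedInputsGreenbergControlAtTwo`, stmt-BirchSwinnertonDyer-24143).  Seat `bsd-inputs-r1-p1` (gen 2) re-pointed that door to
K4's generic residue: `SignedTransportAtTwo.signedTransportAtTwo_rankZero_of_poitouTate_four : poitouTate_selmerStructure_duality ℚ →
poitouTate_sha_tateDual ℚ → poitouTate_three_realPlaces_injective ℚ → poitouTate_two_realPlaces_surjective ℚ → GZK →
MazurTateCongruenceAtTwoR → K1Ar` (p621273).  Since 2026-08-28 11:36Z ALL FOUR Poitou–Tate rows over `ℚ` are THEOREMS of the tree:

* Milne *ADT* I Thm. 4.10 (b) (Selmer structures): `SignedEC.PoitouTateSelmerRat.stub_poitouTateSelmerRat` (p625615, from cell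
  bsd-schneider door-c4's `poitouTate_selmerStructure_duality_holds`);
* Thm. 4.10 (a): `SignedEC.PoitouTateShaRat.stub_poitouTateShaRat` (p629917, seat bsd-inputs-k4-p1 over doors c4/c5 and the
  `Ш²`-readout road);
* Thm. 4.10 (c)₃: `SignedEC.ShaThreeBrauer.poitouTate_three_realPlaces_injective_holds ℚ` (p628282, bsd-wall K4 width seat w3 g9:
  Tate's `H³(Γ_F, F̄ˣ) = 0`, Brauer–Hasse–Noether, the lead's dévissage);
* Cor. 4.16: `Literature.NumberTheory.GaloisCohomology.poitouTate_two_realPlaces_surjective_holds ℚ` (p618871, width seat w2 g6).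

This file discharges them: **`signedTransportAtTwo_rankZero_of_gzk : rank_eq_analyticRank_of_analyticRank_le_one →
MazurTateCongruenceAtTwoR → K1Ar`** (K1Ar = the text of K1 `SignedTransportAtTwo` with `A.analyticRank = 0` inserted; the
conclusion of items 25785's twin VERBATIM).  USE (pen of TP2, its call): a twin `SignedTransportAtTwoRankZeroOfGZK :=
RankEqAnalyticRankLeOne → MazurTateCongruenceAtTwoR → K1Ar` closes by `exact signedTransportAtTwo_rankZero_of_gzk`, after which
`hPubG` feeds K2R0P♭ alone (K4 `SignedControlAtTwo` is closed unconditionally, p-file `…SignedControlAtTwo.lean`, 11:42Z).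

Seat `prover-bsd-wall-tp2-p3-w3` (K4 width 3/3, gen 10), `--supports stmt-BirchSwinnertonDyer-24143`.  Nothing is re-derived:
one `exact` over r1-p1's door and the four theorems.

HONEST FRAMING.  CONDITIONAL on the displayed hypotheses GZK (`rank_eq_analyticRank_of_analyticRank_le_one`, Gross–Zagier–Kolyvagin,
published) and `MazurTateCongruenceAtTwoR` (stmt-BirchSwinnertonDyer-21416, the K1 research crux — OPEN); closes no item; the
Greenberg 1999 inputs (Props. 4.12/4.13, corank count) and Kato Thm. 12.4 no longer enter K1 at the rank-0 partner.  BSD is NOT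
proved by any of this.
-/

set_option autoImplicit false
-- the Theorems namespace of this sub repeats the summit name by design (D-0017 nested layout)
set_option linter.dupNamespace false

noncomputable section

open scoped Classical

open Literature.NumberTheory.EllipticCurves Literature.NumberTheory.GaloisCohomology

namespace Summit.BirchSwinnertonDyer.BirchSwinnertonDyer.Theorems.SignedTransportAtTwo

/-- **K1 at the rank-0 partner (K1Ar) from GZK and `MazurTateCongruenceAtTwoR` alone**: the door
`signedTransportAtTwo_rankZero_of_poitouTate_four` with its four Poitou–Tate rows over `ℚ` discharged by the tree theorems
`PoitouTateSelmerRat.stub_poitouTateSelmerRat` (4.10 (b)), `PoitouTateShaRat.stub_poitouTateShaRat` (4.10 (a)),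
`ShaThreeBrauer.poitouTate_three_realPlaces_injective_holds ℚ` (4.10 (c)₃) and `poitouTate_two_realPlaces_surjective_holds ℚ`
(Cor. 4.16).  Conditional on GZK and the research crux 21416; BSD is not proved by this.
[cite: MilneADT2006, Ch. I, Thm. 4.10 (a)(b)(c), Cor. 4.16] [cite: GreenbergVatsal2000, Thm. (1.4), Props. (2.1), (2.4), (2.5), (2.8)]
[cite: BDKim2009, Cor. 2.13] [cite: BDKim2013, Thm. 1.1] [cite: Kobayashi2003, Thm. 1.2] -/
theorem signedTransportAtTwo_rankZero_of_gzk (hGZK : rank_eq_analyticRank_of_analyticRank_le_one)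
    (hMT : Summit.BirchSwinnertonDyer.BirchSwinnertonDyer.Theses.ThetaPartnerAtTwo.MazurTateCongruenceAtTwoR) :
    ∀ (W : WeierstrassCurve ℚ) [W.IsElliptic] [W.IsGloballyMinimal] (A : WeierstrassCurve ℚ) [A.IsElliptic] [A.IsGloballyMinimal], ¬ W.HasCM →
      W.analyticRank = 0 → Literature.NumberTheory.EllipticCurves.Rank1Residual.GoodSS W 2 → W.frobeniusTrace 2 = 0 →
      A.HasCM → A.analyticRank = 0 → Literature.NumberTheory.EllipticCurves.Rank1Residual.GoodSS A 2 →
      A.frobeniusTrace 2 = 0 →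
      (∃ e : WeierstrassCurve.geomTorsion W (2 : ℤ) ≃+ WeierstrassCurve.geomTorsion A (2 : ℤ), ∀ (σ : Field.absoluteGaloisGroup ℚ) (P : WeierstrassCurve.geomTorsion W (2 : ℤ)), e (σ • P) = σ • e P) →
      ∀ [NeZero (A.conductorNorm ℤ)] (fA : CuspForm (CongruenceSubgroup.Gamma0 (A.conductorNorm ℤ)) 2), Literature.NumberTheory.EllipticCurves.ModularForms.IsNewformOf A fA →
      ∀ (ϖA : ℚ), (ϖA : ℝ) * A.realPeriodRat = Literature.NumberTheory.EllipticCurves.ModularForms.plusPeriod fA →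
      ∀ (LsharpA LflatA : Literature.NumberTheory.EllipticCurves.IwasawaAlgebra 2), Summit.BirchSwinnertonDyer.Rank1Residual.Supersingular.IsPollackPair fA 2 LsharpA LflatA →
      (∀ (κ : Literature.NumberTheory.EllipticCurves.ZpExtension ℚ 2) (γ : Field.absoluteGaloisGroup ℚ), κ.IsCyclotomic →
      κ.IsTopGenerator γ →
      ∀ D : Literature.NumberTheory.EllipticCurves.Kobayashi2003.SignedSelmerDualData A κ γ 1, Module.IsTorsion (Literature.NumberTheory.EllipticCurves.IwasawaAlgebra 2) D.X ∧ D.mu = 0) →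
      Summit.BirchSwinnertonDyer.Rank1Residual.Supersingular.KobayashiMainConjecture A 2 1 →
      (∀ (κ : Literature.NumberTheory.EllipticCurves.ZpExtension ℚ 2) (γ : Field.absoluteGaloisGroup ℚ), κ.IsCyclotomic →
      κ.IsTopGenerator γ → Literature.NumberTheory.EllipticCurves.IsCyclotomicVariable 2 γ →
      ∀ [NeZero (W.conductorNorm ℤ)] (f : CuspForm (CongruenceSubgroup.Gamma0 (W.conductorNorm ℤ)) 2), Literature.NumberTheory.EllipticCurves.ModularForms.IsNewformOf W f →
      ∀ (ϖ : ℚ), (ϖ : ℝ) * W.realPeriodRat = Literature.NumberTheory.EllipticCurves.ModularForms.plusPeriod f →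
      ∀ (Lplus Lminus : Literature.NumberTheory.EllipticCurves.IwasawaAlgebra 2), Summit.BirchSwinnertonDyer.Rank1Residual.Supersingular.IsPollackPair f 2 Lplus Lminus →
      ∀ (D : Literature.NumberTheory.EllipticCurves.Kobayashi2003.SignedSelmerDualData W κ γ 1), ∃ (g h : Literature.NumberTheory.EllipticCurves.IwasawaAlgebra 2) (m : ℕ), D.charIdeal = Ideal.span {g} ∧ Literature.NumberTheory.EllipticCurves.iwasawaToPowerSeries 2 (g * h) = PowerSeries.C ((2 : ℚ_[2]) ^ m * (ϖ : ℚ_[2])) * Literature.NumberTheory.EllipticCurves.iwasawaToPowerSeries 2 (Summit.BirchSwinnertonDyer.Rank1Residual.Supersingular.kobayashiL 1 Lplus Lminus)) →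
      Summit.BirchSwinnertonDyer.Rank1Residual.Supersingular.KobayashiMainConjecture W 2 1 :=
  signedTransportAtTwo_rankZero_of_poitouTate_four SignedEC.PoitouTateSelmerRat.stub_poitouTateSelmerRat
    SignedEC.PoitouTateShaRat.stub_poitouTateShaRat (SignedEC.ShaThreeBrauer.poitouTate_three_realPlaces_injective_holds ℚ)
    (poitouTate_two_realPlaces_surjective_holds ℚ) hGZK hMT

end Summit.BirchSwinnertonDyer.BirchSwinnertonDyer.Theorems.SignedTransportAtTwo

end
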